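import Summits.QuantumFields.YangMills.Theorems.AllWindowsColdBoxBoxHighLineCubicVertexPoly

/-!
# U5 K4′: the cubic tensor OF RECORD `Tc` (7a) — `|cubicVertex − β·Σ_p tripleForm (Tc p) (plaqVar p)| ≤ C·β·H⁴·s⁵` with `Tc` EXPOSED, and the sign glue

Free-hands helper of LEAD ym-line-sfw-p2 g78 for the hK4/hK3 row sums of the NEXT rung U5 (`stub_landauThirdOrder`, LINE-20, ⟨stmt-QuantumFields-24336⟩), planner ruling
2026-08-30T00:59:14Z «LEAD picks ONE P of record when fixing Tc from ✓7a and says which».  w5 g24's ✓`EdgeChartGaussian.exists_cubicVertexPoly` hides the tensor behind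
`∃ F`; the K4′ rows R1/R2/R4 (✓p753305, w5, w2) are stated for `P := β·Σ_p tripleForm (Tc p) (plaqVar …)` with `∀ Tc, |Tc| ≤ B`, so the assembler needs the tensor itself:

* ★ `EdgeChartGaussian.exists_Tc_record` — ONE tensor `Tc : ZdPlaquette 4 → Fin 4 → Fin 4 → Fin 4 → ℝ` (independent of `H`, `β`), `|Tc p i j k| ≤ B`, with
  `|cubicVertex β H a − β·Σ_{p ∈ plaquettesTouching (boxEdges 4 (2H+1))} tripleForm (Tc p) (plaqVar H p …) a| ≤ C·β·H⁴·s⁵` for all `H ≥ 1`, `β > 0`, `s ≥ 0`, `a ∈ smallField H s`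
  (same proof as w5's, ✓7a `wilsonPlaquetteTaylor` + ✓`abs_odd_sub_tripleForm_le` + ✓`TiltSup.card_plaquettesTouching_le'`);
* `tripleForm_neg_left`, `tripleFormSum_neg_left` — `tripleForm (−T) v = −tripleForm T v` and the `P`-level identity `P_{−Tc} = −P_{Tc}`;
* ★ `abs_tiltUOdd_sub_tripleFormSum_neg_le` — the ν-SUPPLIER for the composition's `N := Uᵒ − P_{Tc′}` at `Tc′ := −Tc`:
  `|Uᵒ a − P_{−Tc} a| ≤ |Uᵒ a + cubicVertex β H a| + C·β·H⁴·s⁵` on `smallField H s` (the first summand is w2 g33's ★(0) `abs_tiltU_odd_add_cubicVertex_le`, kept as a term).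

No definitions; standard axioms.  HONEST LABEL: helper-grade U5 prep; U5, ⟨24004⟩, ⟨24336⟩ remain OPEN; route AllWindowsColdBox is DRAFT; no crux, rung or summit is
proved; **the Yang–Mills mass gap is NOT proved by this file; no summit is proved by a line.**
-/

set_option autoImplicit false

noncomputable section

open MeasureTheory Matrix Finset
open Literature.Probability.LatticeModels (Site)
open Literature.MathematicalPhysics.QuantumLattice (ZdPlaquette plaquettesTouching)
open Literature.MathematicalPhysics.QuantumFieldTheory.AxialGauge (boxEdges)

namespace Summit.QuantumFields.YangMills.Theorems.AllWindowsColdBoxBoxHighLine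

namespace EdgeChartGaussian

/-- `tripleForm` is linear in the tensor: `tripleForm (−T) v = −tripleForm T v`. -/
theorem tripleForm_neg_left (T : Fin 4 → Fin 4 → Fin 4 → ℝ) (v : Fin 4 → E3) :
    tripleForm (fun i j k => -T i j k) v = -tripleForm T v := by
  unfold tripleForm
  simp only [neg_mul, Finset.sum_neg_distrib]

/-- The `P`-level sign identity: `β·Σ_p tripleForm (−Tc p) (plaqVar p) = −(β·Σ_p tripleForm (Tc p) (plaqVar p))`. -/
theorem tripleFormSum_neg_left (H : ℕ) (β : ℝ) (S : Finset (ZdPlaquette 4)) (Tc : ZdPlaquette 4 → Fin 4 → Fin 4 → Fin 4 → ℝ) (a : LandauFree H → E3) :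
    β * ∑ p ∈ S, tripleForm (fun i j k => -Tc p i j k) (plaqVar H p.1 p.2.1.1 p.2.1.2 a) =
      -(β * ∑ p ∈ S, tripleForm (Tc p) (plaqVar H p.1 p.2.1.1 p.2.1.2 a)) := by
  simp only [tripleForm_neg_left, Finset.sum_neg_distrib, mul_neg]

/-- ★ **The cubic tensor of record** (7a, exposed): ONE `Tc` with `|Tc| ≤ B` and `|V₃ − β·Σ_p tripleForm (Tc p) (plaqVar p)| ≤ C·β·H⁴·s⁵` on every small-field set. -/
theorem exists_Tc_record : ∃ C B : ℝ, 0 ≤ C ∧ 0 ≤ B ∧ ∃ Tc : ZdPlaquette 4 → Fin 4 → Fin 4 → Fin 4 → ℝ, (∀ p i j k, |Tc p i j k| ≤ B) ∧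
    ∀ H : ℕ, 1 ≤ H → ∀ β : ℝ, 0 < β → ∀ s : ℝ, 0 ≤ s → ∀ a ∈ smallField H s,
      |cubicVertex β H a - β * ∑ p ∈ plaquettesTouching (boxEdges 4 (2 * H + 1)), tripleForm (Tc p) (plaqVar H p.1 p.2.1.1 p.2.1.2 a)| ≤
        C * β * (H : ℝ) ^ 4 * s ^ 5 := by
  classical
  obtain ⟨C7, h7⟩ := wilsonPlaquetteTaylor
  choose Tf hTf h7f using h7
  let T : ZdPlaquette 4 → Fin 4 → Fin 4 → Fin 4 → ℝ := fun p => Tf p.2.1.1 p.2.1.2 (ne_of_lt p.2.2)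
  have hT : ∀ p i j k, |T p i j k| ≤ C7 := fun p => hTf _ _ _
  have hC7 : 0 ≤ C7 := (abs_nonneg _).trans (hT (((0 : Site 4), ⟨(0, 1), by decide⟩) : ZdPlaquette 4) 0 0 0)
  refine ⟨4096 * 1024 * (4 + 6 * C7), C7, by positivity, hC7, T, hT, fun H hH β hβ s hs a ha => ?_⟩
  have hV : cubicVertex β H a - β * ∑ p ∈ plaquettesTouching (boxEdges 4 (2 * H + 1)), tripleForm (T p) (plaqVar H p.1 p.2.1.1 p.2.1.2 a) =
      β * ∑ p ∈ plaquettesTouching (boxEdges 4 (2 * H + 1)),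
        (chartPlaqCostOdd H p.1 p.2.1.1 p.2.1.2 a - tripleForm (T p) (plaqVar H p.1 p.2.1.1 p.2.1.2 a)) := by
    unfold cubicVertex
    rw [Finset.sum_sub_distrib, mul_sub]
  rw [hV, abs_mul, abs_of_pos hβ]
  have hR : ∀ p ∈ plaquettesTouching (boxEdges 4 (2 * H + 1)),
      |chartPlaqCostOdd H p.1 p.2.1.1 p.2.1.2 a - tripleForm (T p) (plaqVar H p.1 p.2.1.1 p.2.1.2 a)| ≤ (4 + 6 * C7) * (4 * s) ^ 5 := by
    intro p _
    have h1 := abs_odd_sub_tripleForm_le (hTf _ _ (ne_of_lt p.2.2)) H p.1 p.2.1.1 p.2.1.2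
      (fun t a ht ht1 hv => (h7f _ _ (ne_of_lt p.2.2) H p.1 t a ht ht1 hv).2) a
    refine h1.trans (mul_le_mul_of_nonneg_left ?_ (by positivity))
    exact pow_le_pow_left₀ (Finset.sum_nonneg fun i _ => norm_nonneg _) (TiltSup.sum_norm_plaqVar_le hs ha p.1 p.2.1.1 p.2.1.2) 5
  have hsum := (Finset.abs_sum_le_sum_abs _ _).trans (Finset.sum_le_sum hR)
  rw [Finset.sum_const, nsmul_eq_mul] at hsum
  have hcard := TiltSup.card_plaquettesTouching_le' (H := H) hH
  have hq : 0 ≤ (4 + 6 * C7) * (4 * s) ^ 5 := by positivity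
  calc β * |∑ p ∈ plaquettesTouching (boxEdges 4 (2 * H + 1)),
          (chartPlaqCostOdd H p.1 p.2.1.1 p.2.1.2 a - tripleForm (T p) (plaqVar H p.1 p.2.1.1 p.2.1.2 a))|
      ≤ β * ((plaquettesTouching (boxEdges 4 (2 * H + 1))).card * ((4 + 6 * C7) * (4 * s) ^ 5)) := mul_le_mul_of_nonneg_left hsum hβ.le
    _ ≤ β * (4096 * (H : ℝ) ^ 4 * ((4 + 6 * C7) * (4 * s) ^ 5)) := mul_le_mul_of_nonneg_left (mul_le_mul_of_nonneg_right hcard hq) hβ.le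
    _ = 4096 * 1024 * (4 + 6 * C7) * β * (H : ℝ) ^ 4 * s ^ 5 := by ring

/-- ★ **ν-supplier for the composition's odd remainder** at `Tc′ := −Tc`: on `smallField H s`,
`|Uᵒ a − β·Σ_p tripleForm (−Tc p) (plaqVar p) a| ≤ |Uᵒ a + cubicVertex β H a| + C·β·H⁴·s⁵`, `Uᵒ a = (tiltU a − tiltU(−a))/2`
(with the `C`, `Tc` of `exists_Tc_record`; the first summand is the odd ghost tail, w2 g33's `abs_tiltU_odd_add_cubicVertex_le`). -/
theorem abs_tiltUOdd_sub_tripleFormSum_neg_le : ∃ C B : ℝ, 0 ≤ C ∧ 0 ≤ B ∧ ∃ Tc : ZdPlaquette 4 → Fin 4 → Fin 4 → Fin 4 → ℝ, (∀ p i j k, |Tc p i j k| ≤ B) ∧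
    (∀ H : ℕ, 1 ≤ H → ∀ β : ℝ, 0 < β → ∀ s : ℝ, 0 ≤ s → ∀ a ∈ smallField H s,
      |cubicVertex β H a - β * ∑ p ∈ plaquettesTouching (boxEdges 4 (2 * H + 1)), tripleForm (Tc p) (plaqVar H p.1 p.2.1.1 p.2.1.2 a)| ≤
        C * β * (H : ℝ) ^ 4 * s ^ 5) ∧
    ∀ H : ℕ, 1 ≤ H → ∀ β : ℝ, 0 < β → ∀ s : ℝ, 0 ≤ s → ∀ a ∈ smallField H s,
      |(tiltU β H a - tiltU β H (-a)) / 2 - β * ∑ p ∈ plaquettesTouching (boxEdges 4 (2 * H + 1)),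
          tripleForm (fun i j k => -Tc p i j k) (plaqVar H p.1 p.2.1.1 p.2.1.2 a)| ≤
        |(tiltU β H a - tiltU β H (-a)) / 2 + cubicVertex β H a| + C * β * (H : ℝ) ^ 4 * s ^ 5 := by
  obtain ⟨C, B, hC, hB, Tc, hT, hrec⟩ := exists_Tc_record
  refine ⟨C, B, hC, hB, Tc, hT, hrec, fun H hH β hβ s hs a ha => ?_⟩
  rw [tripleFormSum_neg_left, sub_neg_eq_add]
  have h1 := hrec H hH β hβ s hs a ha
  set Uo := (tiltU β H a - tiltU β H (-a)) / 2
  set P := β * ∑ p ∈ plaquettesTouching (boxEdges 4 (2 * H + 1)), tripleForm (Tc p) (plaqVar H p.1 p.2.1.1 p.2.1.2 a)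
  calc |Uo + P| = |(Uo + cubicVertex β H a) - (cubicVertex β H a - P)| := by ring_nf
    _ ≤ |Uo + cubicVertex β H a| + |cubicVertex β H a - P| := abs_sub _ _
    _ ≤ _ := by linarith

end EdgeChartGaussian

end Summit.QuantumFields.YangMills.Theorems.AllWindowsColdBoxBoxHighLine

end
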